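import Literature.MathematicalPhysics.KineticTheory.ReyBelletThomas2002
import Literature.MathematicalPhysics.KineticTheory.LangevinChainGibbs
import Mathlib.Analysis.Calculus.LineDeriv.IntegrationByParts
import HarnessLib

/-!
# Rey-Bellet–Thomas 2002: the Gibbs density `e^{-G/T}` is stationary at equilibrium (proof)

Topic `Literature/MathematicalPhysics/KineticTheory` (trunk T-KINETIC). DISCHARGE of the named fact
`ReyBelletThomas2002_equilibrium` of `ReyBelletThomas2002.lean`:
`theorem ReyBelletThomas2002_equilibrium_holds : ReyBelletThomas2002_equilibrium`.

## Source

L. Rey-Bellet, L. E. Thomas, *Exponential convergence to non-equilibrium stationary states in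
classical statistical mechanics*, Comm. Math. Phys. **225** (2002) 305–329 (arXiv:math-ph/0110024),
§2, between the display defining the generator
`L = γ(∇_r T ∇_r - r ∇_r) + (Λ p ∇_r - r Λ ∇_p) + (p ∇_q - ∇_q V ∇_p)` of the effective equations
(arXiv (e23)) and Theorem 2.1: "There is a natural energy function … `G(p,q,r) = r²/2 + H(p,q)`.
A straightforward computation shows that in the special case `T_1 = T_n = T`, `Z⁻¹ e^{-G(p,q,r)/T}`
is an invariant measure for the Markov process `x(t)`" (L. Rey-Bellet, *Open classical systems*,
LNM 1881 (2006), §3 eq. (75): `L^T e^{-βG} = 0`, `L^T` the formal adjoint). The vendored fact is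
the weak form of that computation: `∫ (L f) e^{-G/T} dp dq dr = 0` for every `f ∈ C_c^∞`.

## The straightforward computation (what is proved here)

Write `ρ = e^{-G/T}`, so that `∂_{q_i} ρ = -(∂_{q_i}H/T) ρ`, `∂_{p_i} ρ = -(p_i/T) ρ`,
`∂_{r_α} ρ = -(r_α/T) ρ`. Two patterns exhaust the generator:

* SKEW PAIRS (`integral_skewPair_mul_eq_zero`): if `∂_v ρ = -(b/T) ρ`, `∂_w ρ = -(a/T) ρ`, `a` is
  constant along `v` and `b` along `w`, then `∫ (a ∂_v f - b ∂_w f) ρ = 0` (each term equals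
  `T⁻¹ ∫ a b f ρ` after one integration by parts). Instances: the Liouville terms
  (`a = p_i, v = ∂_{q_i}`, `b = ∂_{q_i}H, w = ∂_{p_i}`) and the two coupling terms
  (`a = p_i, v = ∂_{r_α}`, `b = r_α, w = ∂_{p_i}`).
* ORNSTEIN–UHLENBECK (`integral_ornsteinUhlenbeck_mul_eq_zero`): if `∂_v ρ = -(a/T) ρ` and
  `T ≠ 0` then `∫ (T ∂_v ∂_v f - a ∂_v f) ρ = 0` (`∫ ρ ∂_v(∂_v f) = T⁻¹ ∫ a (∂_v f) ρ`).
  Instances: the reservoir terms `γ(T ∂²_{r_α} - r_α ∂_{r_α})` at `T_L = T_R = T`.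

Both are proved on a finite-dimensional real space with an additive Haar measure from Mathlib's
`integral_bilinear_hasLineDerivAt_right_eq_neg_left_of_integrable`; the coordinate derivatives
`rbPartialQ/rbPartialP/partialRL/partialRR` of `ReyBelletThomas2002.lean` are identified with line
derivatives along `((e_i,0),0)`, `((0,e_i),0)`, `(0,(1,0))`, `(0,(0,1))` of
`RBPhaseSpace N = PhaseSpace N × ℝ²`, whose Lebesgue measure is a Haar measure.

## Main statements

* `OscillatorChain.integral_rbGenerator_mul_exp_neg_rbEnergy_div`: for `C¹` potentials, `T ≠ 0`,
  any `N`, `Λ`, `γ` and `f ∈ C²_c`, `∫ (L_{T,T} f) e^{-G/T} = 0` (hypotheses weaker than the fact's).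
* `ReyBelletThomas2002_equilibrium_holds`: the named fact.

## Design choices

Theorems only (no new definitions, no new named facts). The Hamiltonian calculus
(`partialQ_eq_lineDeriv`, `hasLineDerivAt_hamiltonian_unitP/unitQ`, `contDiff_hamiltonian`,
`isAddHaarMeasure_volume_phaseSpace`) is imported from `LangevinChainNESSProofs.lean` /
`LangevinChainGibbs.lean`, where the same computation is done for the Langevin-bath chain.
-/

noncomputable section

open MeasureTheory
open scoped ContDiff

namespace Literature.MathematicalPhysics.KineticTheory.HeatConduction

/-! ### Generic calculus: the directional derivative `x ↦ ∂_v f(x)` of a `C^k` function -/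

section Generic

variable {X : Type*} [NormedAddCommGroup X] [NormedSpace ℝ X]

/-- For differentiable `f`, `∂_v f = Df · v` as functions of the base point. [folklore] -/
theorem lineDeriv_apply_eq_fderiv_apply {f : X → ℝ} (hf : Differentiable ℝ f) (v : X) :
    (fun x => lineDeriv ℝ f x v) = fun x => fderiv ℝ f x v :=
  funext fun x => (hf x).lineDeriv_eq_fderiv

/-- For differentiable `f`, `∂_v f(x)` is the line derivative of `f` at `x` along `v`. [folklore] -/
theorem hasLineDerivAt_lineDeriv_of_differentiable {f : X → ℝ} (hf : Differentiable ℝ f)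
    (v x : X) : HasLineDerivAt ℝ f (lineDeriv ℝ f x v) x v :=
  (hf x).lineDifferentiableAt.hasLineDerivAt

/-- For `f ∈ C¹`, `x ↦ ∂_v f(x)` is continuous. [folklore] -/
theorem continuous_lineDeriv_apply {f : X → ℝ} {n : WithTop ℕ∞} (hf : ContDiff ℝ n f)
    (hn : n ≠ 0) (v : X) : Continuous fun x => lineDeriv ℝ f x v := by
  rw [lineDeriv_apply_eq_fderiv_apply (hf.differentiable hn) v]
  exact (hf.continuous_fderiv hn).clm_apply continuous_const

/-- For `f ∈ C^{m+1}`, `x ↦ ∂_v f(x)` is `C^m`. [folklore] -/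
theorem contDiff_lineDeriv_apply {f : X → ℝ} {m n : WithTop ℕ∞} (hf : ContDiff ℝ n f)
    (hmn : m + 1 ≤ n) (v : X) : ContDiff ℝ m fun x => lineDeriv ℝ f x v := by
  have hn : n ≠ 0 := by
    rintro rfl
    exact absurd hmn (by simp)
  rw [lineDeriv_apply_eq_fderiv_apply (hf.differentiable hn) v]
  exact (hf.fderiv_right hmn).clm_apply contDiff_const

/-- `x ↦ ∂_v f(x)` has compact support if `f` has. [folklore] -/
theorem hasCompactSupport_lineDeriv_apply {f : X → ℝ} (hf : Differentiable ℝ f)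
    (hfc : HasCompactSupport f) (v : X) : HasCompactSupport fun x => lineDeriv ℝ f x v := by
  rw [lineDeriv_apply_eq_fderiv_apply hf v]
  exact hfc.fderiv_apply ℝ v

variable [FiniteDimensional ℝ X] [MeasurableSpace X] [BorelSpace X] (μ : Measure X)
  [μ.IsAddHaarMeasure]

/-- Integration by parts along a direction `v` of a finite-dimensional real space with an additive
Haar measure, for a continuous `F` with continuous line derivative `F'` against a compactly
supported `C¹` test function `g`: `∫ F ∂_v g = -∫ (∂_v F) g`. [folklore] -/
theorem integral_mul_eq_neg_integral_mul_of_hasLineDerivAt {F F' g g' : X → ℝ} {v : X}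
    (hF : Continuous F) (hF' : Continuous F') (hg : Continuous g) (hg' : Continuous g')
    (hgc : HasCompactSupport g) (hg'c : HasCompactSupport g')
    (hFd : ∀ x, HasLineDerivAt ℝ F (F' x) x v) (hgd : ∀ x, HasLineDerivAt ℝ g (g' x) x v) :
    ∫ x, F x * g' x ∂μ = -∫ x, F' x * g x ∂μ := by
  have e := integral_bilinear_hasLineDerivAt_right_eq_neg_left_of_integrable
    (μ := μ) (B := ContinuousLinearMap.mul ℝ ℝ) (f := F) (f' := F') (g := g) (g' := g') (v := v)
    ?_ ?_ ?_ (fun x _ => hFd x) (fun x _ => hgd x)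
  · simpa using e
  · exact (hF'.mul hg).integrable_of_hasCompactSupport hgc.mul_left
  · exact (hF.mul hg').integrable_of_hasCompactSupport hg'c.mul_left
  · exact (hF.mul hg).integrable_of_hasCompactSupport hgc.mul_left

omit [FiniteDimensional ℝ X] in
/-- The skew-pair integrand `(a ∂_v f - b ∂_w f) ρ` is integrable (continuous, compact support).
[folklore] -/
theorem integrable_skewPair_mul {a b ρ f : X → ℝ} {v w : X} (ha : Continuous a)
    (hb : Continuous b) (hρ : Continuous ρ) (hf : ContDiff ℝ 1 f) (hfc : HasCompactSupport f) :
    Integrable (fun x => (a x * lineDeriv ℝ f x v - b x * lineDeriv ℝ f x w) * ρ x) μ := by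
  have hfd : Differentiable ℝ f := hf.differentiable one_ne_zero
  refine Continuous.integrable_of_hasCompactSupport
    (((ha.mul (continuous_lineDeriv_apply hf one_ne_zero v)).sub
      (hb.mul (continuous_lineDeriv_apply hf one_ne_zero w))).mul hρ) ?_
  exact (((hasCompactSupport_lineDeriv_apply hfd hfc v).mul_left).sub
    ((hasCompactSupport_lineDeriv_apply hfd hfc w).mul_left)).mul_right

/-- **Skew pairs vanish against `ρ`.** If `∂_v ρ = -(b/T) ρ`, `∂_w ρ = -(a/T) ρ`, `a` is constant
along `v` and `b` along `w` (all continuous), then for `f ∈ C¹_c`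
`∫ (a ∂_v f - b ∂_w f) ρ = 0`: integrating by parts once in each term, both equal `T⁻¹ ∫ a b f ρ`.
This is the mechanism behind `L* e^{-G/T} = 0` for the Hamiltonian and the coupling vector fields
of Rey-Bellet–Thomas. [folklore] -/
theorem integral_skewPair_mul_eq_zero {a b ρ f : X → ℝ} {v w : X} {T : ℝ} (ha : Continuous a)
    (hb : Continuous b) (hρ : Continuous ρ) (hav : ∀ (x : X) (t : ℝ), a (x + t • v) = a x)
    (hbw : ∀ (x : X) (t : ℝ), b (x + t • w) = b x)
    (hρv : ∀ x, HasLineDerivAt ℝ ρ (-(b x / T) * ρ x) x v)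
    (hρw : ∀ x, HasLineDerivAt ℝ ρ (-(a x / T) * ρ x) x w)
    (hf : ContDiff ℝ 1 f) (hfc : HasCompactSupport f) :
    ∫ x, (a x * lineDeriv ℝ f x v - b x * lineDeriv ℝ f x w) * ρ x ∂μ = 0 := by
  have hfd : Differentiable ℝ f := hf.differentiable one_ne_zero
  have hvC := continuous_lineDeriv_apply hf one_ne_zero v
  have hwC := continuous_lineDeriv_apply hf one_ne_zero w
  have hvS := hasCompactSupport_lineDeriv_apply hfd hfc v
  have hwS := hasCompactSupport_lineDeriv_apply hfd hfc w
  have e1 : ∫ x, a x * ρ x * lineDeriv ℝ f x v ∂μ = -∫ x, a x * (-(b x / T) * ρ x) * f x ∂μ := by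
    refine integral_mul_eq_neg_integral_mul_of_hasLineDerivAt μ (ha.mul hρ) (by fun_prop)
      hf.continuous hvC hfc hvS (fun x => ?_) (hasLineDerivAt_lineDeriv_of_differentiable hfd v)
    have h := hρv x
    unfold HasLineDerivAt at h ⊢
    simp only [hav]
    exact h.const_mul (a x)
  have e2 : ∫ x, b x * ρ x * lineDeriv ℝ f x w ∂μ = -∫ x, b x * (-(a x / T) * ρ x) * f x ∂μ := by
    refine integral_mul_eq_neg_integral_mul_of_hasLineDerivAt μ (hb.mul hρ) (by fun_prop)
      hf.continuous hwC hfc hwS (fun x => ?_) (hasLineDerivAt_lineDeriv_of_differentiable hfd w)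
    have h := hρw x
    unfold HasLineDerivAt at h ⊢
    simp only [hbw]
    exact h.const_mul (b x)
  have hsplit : (fun x => (a x * lineDeriv ℝ f x v - b x * lineDeriv ℝ f x w) * ρ x) =
      fun x => a x * ρ x * lineDeriv ℝ f x v - b x * ρ x * lineDeriv ℝ f x w := by
    funext x; ring
  rw [hsplit, integral_sub, e1, e2]
  · have : (fun x => a x * (-(b x / T) * ρ x) * f x) =
        fun x => b x * (-(a x / T) * ρ x) * f x := by
      funext x; ring
    rw [this, sub_self]
  · exact ((ha.mul hρ).mul hvC).integrable_of_hasCompactSupport hvS.mul_left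
  · exact ((hb.mul hρ).mul hwC).integrable_of_hasCompactSupport hwS.mul_left

omit [FiniteDimensional ℝ X] in
/-- The Ornstein–Uhlenbeck integrand `(T ∂_v ∂_v f - a ∂_v f) ρ` is integrable (continuous,
compact support). [folklore] -/
theorem integrable_ornsteinUhlenbeck_mul {a ρ f : X → ℝ} {v : X} {T : ℝ} (ha : Continuous a)
    (hρ : Continuous ρ) (hf : ContDiff ℝ 2 f) (hfc : HasCompactSupport f) :
    Integrable (fun x => (T * lineDeriv ℝ (fun y => lineDeriv ℝ f y v) x v -
      a x * lineDeriv ℝ f x v) * ρ x) μ := by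
  have hfd : Differentiable ℝ f := hf.differentiable two_ne_zero
  have hg : ContDiff ℝ 1 fun y => lineDeriv ℝ f y v := contDiff_lineDeriv_apply hf (by norm_num) v
  have hgS := hasCompactSupport_lineDeriv_apply hfd hfc v
  refine Continuous.integrable_of_hasCompactSupport
    (((continuous_const.mul (continuous_lineDeriv_apply hg one_ne_zero v)).sub
      (ha.mul hg.continuous)).mul hρ) ?_
  exact (((hasCompactSupport_lineDeriv_apply (hg.differentiable one_ne_zero) hgS v).mul_left).sub
    hgS.mul_left).mul_right

/-- **Ornstein–Uhlenbeck terms vanish against `ρ` (fluctuation–dissipation).** If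
`∂_v ρ = -(a/T) ρ` with `a`, `ρ` continuous and `T ≠ 0`, then for `f ∈ C²_c`
`∫ (T ∂_v ∂_v f - a ∂_v f) ρ = 0`, since `∫ ρ ∂_v(∂_v f) = T⁻¹ ∫ a (∂_v f) ρ` by one integration
by parts. [folklore] -/
theorem integral_ornsteinUhlenbeck_mul_eq_zero {a ρ f : X → ℝ} {v : X} {T : ℝ}
    (ha : Continuous a) (hρ : Continuous ρ)
    (hρv : ∀ x, HasLineDerivAt ℝ ρ (-(a x / T) * ρ x) x v) (hT : T ≠ 0)
    (hf : ContDiff ℝ 2 f) (hfc : HasCompactSupport f) :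
    ∫ x, (T * lineDeriv ℝ (fun y => lineDeriv ℝ f y v) x v - a x * lineDeriv ℝ f x v) * ρ x ∂μ
      = 0 := by
  have hfd : Differentiable ℝ f := hf.differentiable two_ne_zero
  have hg : ContDiff ℝ 1 fun y => lineDeriv ℝ f y v := contDiff_lineDeriv_apply hf (by norm_num) v
  have hgd : Differentiable ℝ fun y => lineDeriv ℝ f y v := hg.differentiable one_ne_zero
  have hgC : Continuous fun y => lineDeriv ℝ f y v := hg.continuous
  have hgS := hasCompactSupport_lineDeriv_apply hfd hfc v
  have hg'C := continuous_lineDeriv_apply hg one_ne_zero v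
  have hg'S := hasCompactSupport_lineDeriv_apply hgd hgS v
  have e : ∫ x, ρ x * lineDeriv ℝ (fun y => lineDeriv ℝ f y v) x v ∂μ =
      -∫ x, -(a x / T) * ρ x * lineDeriv ℝ f x v ∂μ :=
    integral_mul_eq_neg_integral_mul_of_hasLineDerivAt μ hρ (by fun_prop) hgC hg'C hgS hg'S hρv
      (hasLineDerivAt_lineDeriv_of_differentiable hgd v)
  have e' : ∫ x, ρ x * lineDeriv ℝ (fun y => lineDeriv ℝ f y v) x v ∂μ =
      T⁻¹ * ∫ x, a x * lineDeriv ℝ f x v * ρ x ∂μ := by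
    rw [e, ← integral_neg, ← integral_const_mul]
    congr 1
    funext x
    ring
  have hsplit : (fun x => (T * lineDeriv ℝ (fun y => lineDeriv ℝ f y v) x v -
      a x * lineDeriv ℝ f x v) * ρ x) =
      fun x => T * (ρ x * lineDeriv ℝ (fun y => lineDeriv ℝ f y v) x v) -
        a x * lineDeriv ℝ f x v * ρ x := by
    funext x; ring
  rw [hsplit, integral_sub, integral_const_mul, e', ← mul_assoc, mul_inv_cancel₀ hT, one_mul,
    sub_self]
  · exact ((hρ.mul hg'C).integrable_of_hasCompactSupport hg'S.mul_left).const_mul T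
  · exact ((ha.mul hgC).mul hρ).integrable_of_hasCompactSupport (hgS.mul_left.mul_right)

end Generic

/-! ### The extended phase space: Haar measure, coordinate derivatives as line derivatives -/

variable {N : ℕ}

/-- Lebesgue measure on the extended phase space `RBPhaseSpace N = PhaseSpace N × ℝ²` is an
additive Haar measure (product of Haar measures). [folklore] -/
theorem isAddHaarMeasure_volume_rbPhaseSpace (N : ℕ) :
    (volume : Measure (RBPhaseSpace N)).IsAddHaarMeasure := by
  haveI := isAddHaarMeasure_volume_phaseSpace N
  exact Measure.prod.instIsAddHaarMeasure _ _

/-- `∂_{q_i}` on the extended phase space is the line derivative along `((e_i, 0), 0)` (for every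
`f`, same junk value). [folklore] -/
theorem rbPartialQ_eq_lineDeriv (i : Fin N) (f : RBPhaseSpace N → ℝ) :
    rbPartialQ i f = fun x => lineDeriv ℝ f x (((Pi.single i 1, 0), 0) : RBPhaseSpace N) := by
  funext x
  rw [rbPartialQ, partialQ_eq_lineDeriv]
  simp only [lineDeriv]
  congr 1
  funext t
  congr 1
  ext <;> simp

/-- `∂_{p_i}` on the extended phase space is the line derivative along `((0, e_i), 0)`.
[folklore] -/
theorem rbPartialP_eq_lineDeriv (i : Fin N) (f : RBPhaseSpace N → ℝ) :
    rbPartialP i f = fun x => lineDeriv ℝ f x (((0, Pi.single i 1), 0) : RBPhaseSpace N) := by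
  funext x
  rw [rbPartialP, partialP_eq_lineDeriv]
  simp only [lineDeriv]
  congr 1
  funext t
  congr 1
  ext <;> simp

/-- `∂_{r_L}` is the line derivative along `(0, (1, 0))`. [folklore] -/
theorem partialRL_eq_lineDeriv (f : RBPhaseSpace N → ℝ) :
    partialRL f = fun x => lineDeriv ℝ f x ((0, (1, 0)) : RBPhaseSpace N) := by
  funext x
  have h : (fun t : ℝ => f (x + t • ((0, (1, 0)) : RBPhaseSpace N))) =
      fun t => (fun s => f (x.1, (s, x.2.2))) (x.2.1 + t) := by
    funext t
    show f (x + t • ((0, (1, 0)) : RBPhaseSpace N)) = f (x.1, (x.2.1 + t, x.2.2))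
    congr 1
    ext <;> simp
  simp only [partialRL, lineDeriv]
  rw [h, deriv_comp_const_add (fun s => f (x.1, (s, x.2.2))) x.2.1 0, add_zero]

/-- `∂_{r_R}` is the line derivative along `(0, (0, 1))`. [folklore] -/
theorem partialRR_eq_lineDeriv (f : RBPhaseSpace N → ℝ) :
    partialRR f = fun x => lineDeriv ℝ f x ((0, (0, 1)) : RBPhaseSpace N) := by
  funext x
  have h : (fun t : ℝ => f (x + t • ((0, (0, 1)) : RBPhaseSpace N))) =
      fun t => (fun s => f (x.1, (x.2.1, s))) (x.2.2 + t) := by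
    funext t
    show f (x + t • ((0, (0, 1)) : RBPhaseSpace N)) = f (x.1, (x.2.1, x.2.2 + t))
    congr 1
    ext <;> simp
  simp only [partialRR, lineDeriv]
  rw [h, deriv_comp_const_add (fun s => f (x.1, (x.2.1, s))) x.2.2 0, add_zero]

namespace OscillatorChain

variable (P : OscillatorChain)

/-! ### The energy `G = r²/2 + H` and the density `e^{-G/T}`: directional derivatives -/

/-- `G` is continuous for continuous potentials. [folklore] -/
theorem continuous_rbEnergy (hU : Continuous P.U) (hV : Continuous P.V) (N : ℕ) :
    Continuous (P.rbEnergy N) := by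
  have h := P.continuous_hamiltonian hU hV N
  exact (by fun_prop :
    Continuous fun x : RBPhaseSpace N => (x.2.1 ^ 2 + x.2.2 ^ 2) / 2 + P.hamiltonian N x.1)

/-- `∂_{q_i} G = ∂_{q_i} H` for a differentiable Hamiltonian. [folklore] -/
theorem hasLineDerivAt_rbEnergy_unitQ {N : ℕ} (hH : Differentiable ℝ (P.hamiltonian N))
    (x : RBPhaseSpace N) (i : Fin N) :
    HasLineDerivAt ℝ (P.rbEnergy N) (partialQ i (P.hamiltonian N) x.1) x
      (((Pi.single i 1, 0), 0) : RBPhaseSpace N) := by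
  have h := P.hasLineDerivAt_hamiltonian_unitQ hH x.1 i
  unfold HasLineDerivAt at h ⊢
  have e : (fun t : ℝ => P.rbEnergy N (x + t • (((Pi.single i 1, 0), 0) : RBPhaseSpace N))) =
      fun t => (x.2.1 ^ 2 + x.2.2 ^ 2) / 2 +
        P.hamiltonian N (x.1 + t • ((Pi.single i 1, 0) : PhaseSpace N)) := by
    funext t
    simp [rbEnergy]
  rw [e]
  exact h.const_add _

/-- `∂_{p_i} G = p_i`. [folklore] -/
theorem hasLineDerivAt_rbEnergy_unitP (N : ℕ) (x : RBPhaseSpace N) (i : Fin N) :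
    HasLineDerivAt ℝ (P.rbEnergy N) (x.1.2 i) x (((0, Pi.single i 1), 0) : RBPhaseSpace N) := by
  have h := P.hasLineDerivAt_hamiltonian_unitP N x.1 i
  unfold HasLineDerivAt at h ⊢
  have e : (fun t : ℝ => P.rbEnergy N (x + t • (((0, Pi.single i 1), 0) : RBPhaseSpace N))) =
      fun t => (x.2.1 ^ 2 + x.2.2 ^ 2) / 2 +
        P.hamiltonian N (x.1 + t • ((0, Pi.single i 1) : PhaseSpace N)) := by
    funext t
    simp [rbEnergy]
  rw [e]
  exact h.const_add _

/-- `∂_{r_L} G = r_L`. [folklore] -/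
theorem hasLineDerivAt_rbEnergy_unitRL (N : ℕ) (x : RBPhaseSpace N) :
    HasLineDerivAt ℝ (P.rbEnergy N) x.2.1 x ((0, (1, 0)) : RBPhaseSpace N) := by
  unfold HasLineDerivAt
  have e : (fun t : ℝ => P.rbEnergy N (x + t • ((0, (1, 0)) : RBPhaseSpace N))) =
      fun t => (x.2.1 + t) ^ 2 / 2 + (x.2.2 ^ 2 / 2 + P.hamiltonian N x.1) := by
    funext t
    simp only [rbEnergy, Prod.fst_add, Prod.snd_add, smul_zero, add_zero, Prod.smul_mk,
      smul_eq_mul, mul_one, mul_zero]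
    ring
  rw [e]
  apply HasDerivAt.add_const
  have h1 : HasDerivAt (fun t : ℝ => x.2.1 + t) 1 0 := (hasDerivAt_id' (0 : ℝ)).const_add _
  refine ((h1.pow 2).div_const 2).congr_deriv ?_
  norm_num

/-- `∂_{r_R} G = r_R`. [folklore] -/
theorem hasLineDerivAt_rbEnergy_unitRR (N : ℕ) (x : RBPhaseSpace N) :
    HasLineDerivAt ℝ (P.rbEnergy N) x.2.2 x ((0, (0, 1)) : RBPhaseSpace N) := by
  unfold HasLineDerivAt
  have e : (fun t : ℝ => P.rbEnergy N (x + t • ((0, (0, 1)) : RBPhaseSpace N))) =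
      fun t => (x.2.2 + t) ^ 2 / 2 + (x.2.1 ^ 2 / 2 + P.hamiltonian N x.1) := by
    funext t
    simp only [rbEnergy, Prod.fst_add, Prod.snd_add, smul_zero, add_zero, Prod.smul_mk,
      smul_eq_mul, mul_one, mul_zero]
    ring
  rw [e]
  apply HasDerivAt.add_const
  have h1 : HasDerivAt (fun t : ℝ => x.2.2 + t) 1 0 := (hasDerivAt_id' (0 : ℝ)).const_add _
  refine ((h1.pow 2).div_const 2).congr_deriv ?_
  norm_num

/-- Chain rule: along any direction, `∂_v e^{-G/T} = -(∂_v G / T) e^{-G/T}`. [folklore] -/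
theorem hasLineDerivAt_exp_neg_rbEnergy_div {N : ℕ} {T D : ℝ} {x v : RBPhaseSpace N}
    (hG : HasLineDerivAt ℝ (P.rbEnergy N) D x v) :
    HasLineDerivAt ℝ (fun y => Real.exp (-(P.rbEnergy N y) / T))
      (-(D / T) * Real.exp (-(P.rbEnergy N x) / T)) x v := by
  unfold HasLineDerivAt at hG ⊢
  refine ((hG.neg.div_const T).exp).congr_deriv ?_
  simp only [Pi.neg_apply, zero_smul, add_zero]
  ring

/-- `e^{-G/T}` is continuous for continuous potentials. [folklore] -/
theorem continuous_exp_neg_rbEnergy_div (hU : Continuous P.U) (hV : Continuous P.V) (N : ℕ)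
    (T : ℝ) : Continuous fun y : RBPhaseSpace N => Real.exp (-(P.rbEnergy N y) / T) :=
  Real.continuous_exp.comp ((P.continuous_rbEnergy hU hV N).neg.div_const T)

/-! ### The three parts of the generator against `e^{-G/T}` -/

/-- **Liouville part.** `∫ (p_i ∂_{q_i} f - ∂_{q_i}H ∂_{p_i} f) e^{-G/T} = 0` for `f ∈ C¹_c`, every
site `i` and every `T` (the Hamiltonian vector field is divergence free and preserves `G`).
[cite: ReyBelletThomas2002, §2 (before Thm 2.1)] -/
theorem integral_rbLiouville_mul_eq_zero (hU : ContDiff ℝ 1 P.U) (hV : ContDiff ℝ 1 P.V) (N : ℕ)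
    (T : ℝ) {f : RBPhaseSpace N → ℝ} (hf : ContDiff ℝ 1 f) (hfc : HasCompactSupport f)
    (i : Fin N) :
    ∫ x, (x.1.2 i * rbPartialQ i f x - partialQ i (P.hamiltonian N) x.1 * rbPartialP i f x) *
      Real.exp (-(P.rbEnergy N x) / T) = 0 := by
  haveI := isAddHaarMeasure_volume_rbPhaseSpace N
  have hH1 : ContDiff ℝ 1 (P.hamiltonian N) := P.contDiff_hamiltonian hU hV N
  have hHd : Differentiable ℝ (P.hamiltonian N) := hH1.differentiable one_ne_zero
  simp only [rbPartialQ_eq_lineDeriv, rbPartialP_eq_lineDeriv]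
  refine integral_skewPair_mul_eq_zero volume (a := fun x : RBPhaseSpace N => x.1.2 i)
    (b := fun x : RBPhaseSpace N => partialQ i (P.hamiltonian N) x.1) (by fun_prop)
    ((P.continuous_partialQ_hamiltonian hH1 i).comp continuous_fst)
    (P.continuous_exp_neg_rbEnergy_div hU.continuous hV.continuous N T)
    (fun x t => by simp) (fun x t => ?_)
    (fun x => P.hasLineDerivAt_exp_neg_rbEnergy_div (P.hasLineDerivAt_rbEnergy_unitQ hHd x i))
    (fun x => P.hasLineDerivAt_exp_neg_rbEnergy_div (P.hasLineDerivAt_rbEnergy_unitP N x i))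
    hf hfc
  show partialQ i (P.hamiltonian N) (x + t • (((0, Pi.single i 1), 0) : RBPhaseSpace N)).1 =
    partialQ i (P.hamiltonian N) x.1
  rw [show (x + t • (((0, Pi.single i 1), 0) : RBPhaseSpace N)).1 =
      x.1 + t • ((0, Pi.single i 1) : PhaseSpace N) by simp]
  exact P.partialQ_hamiltonian_add_smul_unitP N x.1 i i t

/-- **Left coupling part.** `∫ (p_i ∂_{r_L} f - r_L ∂_{p_i} f) e^{-G/T} = 0` for `f ∈ C¹_c`, every
site `i` (the generator uses `i = 0`) and every `T`. [cite: ReyBelletThomas2002, §2 (before Thm 2.1)] -/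
theorem integral_rbCouplingL_mul_eq_zero (hU : Continuous P.U) (hV : Continuous P.V) (N : ℕ)
    (T : ℝ) {f : RBPhaseSpace N → ℝ} (hf : ContDiff ℝ 1 f) (hfc : HasCompactSupport f)
    (i : Fin N) :
    ∫ x, (x.1.2 i * partialRL f x - x.2.1 * rbPartialP i f x) *
      Real.exp (-(P.rbEnergy N x) / T) = 0 := by
  haveI := isAddHaarMeasure_volume_rbPhaseSpace N
  simp only [partialRL_eq_lineDeriv, rbPartialP_eq_lineDeriv]
  exact integral_skewPair_mul_eq_zero volume (a := fun x : RBPhaseSpace N => x.1.2 i)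
    (b := fun x : RBPhaseSpace N => x.2.1) (by fun_prop) (by fun_prop)
    (P.continuous_exp_neg_rbEnergy_div hU hV N T) (fun x t => by simp) (fun x t => by simp)
    (fun x => P.hasLineDerivAt_exp_neg_rbEnergy_div (P.hasLineDerivAt_rbEnergy_unitRL N x))
    (fun x => P.hasLineDerivAt_exp_neg_rbEnergy_div (P.hasLineDerivAt_rbEnergy_unitP N x i))
    hf hfc

/-- **Right coupling part.** `∫ (p_i ∂_{r_R} f - r_R ∂_{p_i} f) e^{-G/T} = 0` for `f ∈ C¹_c`, every
site `i` (the generator uses `i = N - 1`) and every `T`.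
[cite: ReyBelletThomas2002, §2 (before Thm 2.1)] -/
theorem integral_rbCouplingR_mul_eq_zero (hU : Continuous P.U) (hV : Continuous P.V) (N : ℕ)
    (T : ℝ) {f : RBPhaseSpace N → ℝ} (hf : ContDiff ℝ 1 f) (hfc : HasCompactSupport f)
    (i : Fin N) :
    ∫ x, (x.1.2 i * partialRR f x - x.2.2 * rbPartialP i f x) *
      Real.exp (-(P.rbEnergy N x) / T) = 0 := by
  haveI := isAddHaarMeasure_volume_rbPhaseSpace N
  simp only [partialRR_eq_lineDeriv, rbPartialP_eq_lineDeriv]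
  exact integral_skewPair_mul_eq_zero volume (a := fun x : RBPhaseSpace N => x.1.2 i)
    (b := fun x : RBPhaseSpace N => x.2.2) (by fun_prop) (by fun_prop)
    (P.continuous_exp_neg_rbEnergy_div hU hV N T) (fun x t => by simp) (fun x t => by simp)
    (fun x => P.hasLineDerivAt_exp_neg_rbEnergy_div (P.hasLineDerivAt_rbEnergy_unitRR N x))
    (fun x => P.hasLineDerivAt_exp_neg_rbEnergy_div (P.hasLineDerivAt_rbEnergy_unitP N x i))
    hf hfc

/-- **Left reservoir (Ornstein–Uhlenbeck) part at temperature `T`.**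
`∫ (T ∂²_{r_L} f - r_L ∂_{r_L} f) e^{-G/T} = 0` for `f ∈ C²_c`, `T ≠ 0`.
[cite: ReyBelletThomas2002, §2 (before Thm 2.1)] -/
theorem integral_rbBathL_mul_eq_zero (hU : Continuous P.U) (hV : Continuous P.V) (N : ℕ) {T : ℝ}
    (hT : T ≠ 0) {f : RBPhaseSpace N → ℝ} (hf : ContDiff ℝ 2 f) (hfc : HasCompactSupport f) :
    ∫ x, (T * partialRL (partialRL f) x - x.2.1 * partialRL f x) *
      Real.exp (-(P.rbEnergy N x) / T) = 0 := by
  haveI := isAddHaarMeasure_volume_rbPhaseSpace N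
  simp only [partialRL_eq_lineDeriv]
  exact integral_ornsteinUhlenbeck_mul_eq_zero volume (a := fun x : RBPhaseSpace N => x.2.1)
    (by fun_prop) (P.continuous_exp_neg_rbEnergy_div hU hV N T)
    (fun x => P.hasLineDerivAt_exp_neg_rbEnergy_div (P.hasLineDerivAt_rbEnergy_unitRL N x))
    hT hf hfc

/-- **Right reservoir (Ornstein–Uhlenbeck) part at temperature `T`.**
`∫ (T ∂²_{r_R} f - r_R ∂_{r_R} f) e^{-G/T} = 0` for `f ∈ C²_c`, `T ≠ 0`.
[cite: ReyBelletThomas2002, §2 (before Thm 2.1)] -/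
theorem integral_rbBathR_mul_eq_zero (hU : Continuous P.U) (hV : Continuous P.V) (N : ℕ) {T : ℝ}
    (hT : T ≠ 0) {f : RBPhaseSpace N → ℝ} (hf : ContDiff ℝ 2 f) (hfc : HasCompactSupport f) :
    ∫ x, (T * partialRR (partialRR f) x - x.2.2 * partialRR f x) *
      Real.exp (-(P.rbEnergy N x) / T) = 0 := by
  haveI := isAddHaarMeasure_volume_rbPhaseSpace N
  simp only [partialRR_eq_lineDeriv]
  exact integral_ornsteinUhlenbeck_mul_eq_zero volume (a := fun x : RBPhaseSpace N => x.2.2)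
    (by fun_prop) (P.continuous_exp_neg_rbEnergy_div hU hV N T)
    (fun x => P.hasLineDerivAt_exp_neg_rbEnergy_div (P.hasLineDerivAt_rbEnergy_unitRR N x))
    hT hf hfc

/-! ### Assembly: `∫ (L f) e^{-G/T} = 0` -/

/-- **The Gibbs density `e^{-G/T}` is a weak stationary solution of the Rey-Bellet–Thomas dynamics
at equal temperatures.** For `C¹` potentials `U, V`, any `N`, coupling `Λ`, friction `γ`, `T ≠ 0`
and `f ∈ C²_c(X)`: `∫ (L_{T,T} f)(x) e^{-G(x)/T} dx = 0`, where `L_{T_L,T_R} = rbGenerator`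
("in the special case `T_1 = T_n = T`, `Z⁻¹ e^{-G/T}` is an invariant measure"). The Liouville and
coupling parts vanish for every `T`; the reservoir parts by fluctuation–dissipation at `T_L = T_R = T`.
[cite: ReyBelletThomas2002, §2 (before Thm 2.1)] -/
theorem integral_rbGenerator_mul_exp_neg_rbEnergy_div (hU : ContDiff ℝ 1 P.U)
    (hV : ContDiff ℝ 1 P.V) (Λ : ℝ) (N : ℕ) {T : ℝ} (hT : T ≠ 0) {f : RBPhaseSpace N → ℝ}
    (hf : ContDiff ℝ 2 f) (hfc : HasCompactSupport f) :
    ∫ x, P.rbGenerator Λ N T T f x * Real.exp (-(P.rbEnergy N x) / T) = 0 := by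
  haveI := isAddHaarMeasure_volume_rbPhaseSpace N
  have hf1 : ContDiff ℝ 1 f := hf.of_le (by norm_num)
  have hUc : Continuous P.U := hU.continuous
  have hVc : Continuous P.V := hV.continuous
  have hH1 : ContDiff ℝ 1 (P.hamiltonian N) := P.contDiff_hamiltonian hU hV N
  have hρ := P.continuous_exp_neg_rbEnergy_div hUc hVc N T
  have hp : ∀ i : Fin N, Continuous fun x : RBPhaseSpace N => x.1.2 i := fun i => by fun_prop
  -- name the pieces of `(L f) e^{-G/T}`
  set A : Fin N → RBPhaseSpace N → ℝ := fun i x =>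
    (x.1.2 i * rbPartialQ i f x - partialQ i (P.hamiltonian N) x.1 * rbPartialP i f x) *
      Real.exp (-(P.rbEnergy N x) / T) with hA
  set B : RBPhaseSpace N → ℝ := fun x =>
    (T * partialRL (partialRL f) x - x.2.1 * partialRL f x) * Real.exp (-(P.rbEnergy N x) / T) +
      (T * partialRR (partialRR f) x - x.2.2 * partialRR f x) *
        Real.exp (-(P.rbEnergy N x) / T) with hB
  set C : Fin N → RBPhaseSpace N → ℝ := fun i x =>
    (if i.val = 0 then x.1.2 i * partialRL f x - x.2.1 * rbPartialP i f x else 0) *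
        Real.exp (-(P.rbEnergy N x) / T) +
      (if i.val = N - 1 then x.1.2 i * partialRR f x - x.2.2 * rbPartialP i f x else 0) *
        Real.exp (-(P.rbEnergy N x) / T) with hC
  have hsplit : (fun x => P.rbGenerator Λ N T T f x * Real.exp (-(P.rbEnergy N x) / T)) =
      fun x => (∑ i, A i x) + P.γ * B x + Λ * ∑ i, C i x := by
    funext x
    simp only [hA, hB, hC, rbGenerator, add_mul, Finset.sum_mul, mul_assoc]
  -- (A) Liouville
  have intA : ∀ i, Integrable (A i) := fun i => by
    simp only [hA, rbPartialQ_eq_lineDeriv, rbPartialP_eq_lineDeriv]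
    exact integrable_skewPair_mul volume (hp i)
      ((P.continuous_partialQ_hamiltonian hH1 i).comp continuous_fst) hρ hf1 hfc
  have valA : ∀ i, ∫ x, A i x = 0 := fun i => by
    simp only [hA]
    exact P.integral_rbLiouville_mul_eq_zero hU hV N T hf1 hfc i
  -- (B) reservoirs
  have intB1 : Integrable fun x : RBPhaseSpace N =>
      (T * partialRL (partialRL f) x - x.2.1 * partialRL f x) * Real.exp (-(P.rbEnergy N x) / T) := by
    simp only [partialRL_eq_lineDeriv]
    exact integrable_ornsteinUhlenbeck_mul volume (a := fun x : RBPhaseSpace N => x.2.1)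
      (by fun_prop) hρ hf hfc
  have intB2 : Integrable fun x : RBPhaseSpace N =>
      (T * partialRR (partialRR f) x - x.2.2 * partialRR f x) * Real.exp (-(P.rbEnergy N x) / T) := by
    simp only [partialRR_eq_lineDeriv]
    exact integrable_ornsteinUhlenbeck_mul volume (a := fun x : RBPhaseSpace N => x.2.2)
      (by fun_prop) hρ hf hfc
  have intB : Integrable B := intB1.add intB2
  have valB : ∫ x, B x = 0 := by
    simp only [hB]
    rw [integral_add intB1 intB2, P.integral_rbBathL_mul_eq_zero hUc hVc N hT hf hfc,
      P.integral_rbBathR_mul_eq_zero hUc hVc N hT hf hfc, add_zero]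
  -- (C) couplings: `if`-guarded skew pairs
  have hite : ∀ (c : Prop) [Decidable c] (g : RBPhaseSpace N → ℝ),
      Integrable (fun x => g x * Real.exp (-(P.rbEnergy N x) / T)) →
      ∫ x, g x * Real.exp (-(P.rbEnergy N x) / T) = 0 →
      Integrable (fun x => (if c then g x else 0) * Real.exp (-(P.rbEnergy N x) / T)) ∧
        ∫ x, (if c then g x else 0) * Real.exp (-(P.rbEnergy N x) / T) = 0 := by
    intro c _ g hg h0
    by_cases hc : c
    · simp only [if_pos hc]
      exact ⟨hg, h0⟩
    · refine ⟨?_, ?_⟩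
      · simp only [if_neg hc, zero_mul]
        exact integrable_zero _ _ _
      · simp only [if_neg hc, zero_mul, integral_zero]
  have intCL : ∀ i : Fin N, Integrable fun x : RBPhaseSpace N =>
      (x.1.2 i * partialRL f x - x.2.1 * rbPartialP i f x) * Real.exp (-(P.rbEnergy N x) / T) :=
    fun i => by
    simp only [partialRL_eq_lineDeriv, rbPartialP_eq_lineDeriv]
    exact integrable_skewPair_mul volume (hp i) (by fun_prop) hρ hf1 hfc
  have intCR : ∀ i : Fin N, Integrable fun x : RBPhaseSpace N =>
      (x.1.2 i * partialRR f x - x.2.2 * rbPartialP i f x) * Real.exp (-(P.rbEnergy N x) / T) :=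
    fun i => by
    simp only [partialRR_eq_lineDeriv, rbPartialP_eq_lineDeriv]
    exact integrable_skewPair_mul volume (hp i) (by fun_prop) hρ hf1 hfc
  have intvalC : ∀ i, Integrable (C i) ∧ ∫ x, C i x = 0 := fun i => by
    obtain ⟨h1, h1'⟩ := hite (i.val = 0) _ (intCL i)
      (P.integral_rbCouplingL_mul_eq_zero hUc hVc N T hf1 hfc i)
    obtain ⟨h2, h2'⟩ := hite (i.val = N - 1) _ (intCR i)
      (P.integral_rbCouplingR_mul_eq_zero hUc hVc N T hf1 hfc i)
    refine ⟨h1.add h2, ?_⟩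
    simp only [hC]
    rw [integral_add h1 h2, h1', h2', add_zero]
  -- assemble
  have iA : Integrable fun x => ∑ i, A i x := integrable_finsetSum _ fun i _ => intA i
  have iC : Integrable fun x => ∑ i, C i x := integrable_finsetSum _ fun i _ => (intvalC i).1
  have iB' : Integrable fun x => P.γ * B x := intB.const_mul _
  have iC' : Integrable fun x => Λ * ∑ i, C i x := iC.const_mul _
  have iAB : Integrable fun x => (∑ i, A i x) + P.γ * B x := iA.add iB'
  rw [hsplit, integral_add iAB iC', integral_add iA iB', integral_const_mul, integral_const_mul,
    integral_finsetSum _ (fun i _ => intA i), integral_finsetSum _ (fun i _ => (intvalC i).1),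
    Finset.sum_eq_zero (fun i _ => valA i), Finset.sum_eq_zero (fun i _ => (intvalC i).2), valB]
  ring

end OscillatorChain

/-! ### Discharge of the named fact -/

/-- DISCHARGE of `ReyBelletThomas2002_equilibrium`: for smooth potentials, `T > 0`, every `N`, `Λ`
and every `f ∈ C_c^∞`, `∫ (L_{T,T} f) e^{-G/T} = 0` ("in the special case `T_1 = T_n = T`,
`Z⁻¹ e^{-G(p,q,r)/T}` is an invariant measure for the Markov process `x(t)`").
[cite: ReyBelletThomas2002, §2 (before Thm 2.1)] -/
theorem ReyBelletThomas2002_equilibrium_holds : ReyBelletThomas2002_equilibrium := by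
  intro P Λ N T hT hU hV f hf hfc
  exact P.integral_rbGenerator_mul_exp_neg_rbEnergy_div (hU.of_le (by norm_cast))
    (hV.of_le (by norm_cast)) Λ N hT.ne' (hf.of_le (by norm_cast)) hfc

end Literature.MathematicalPhysics.KineticTheory.HeatConduction
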